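import Summits.AnomalousDissipation.AnomalousDissipation.Theorems.SolenoidalFractalHomogenisationLagrangianStepDefs
import Literature.Analysis.FluidPDE.PassiveVectorTensorDistortedDuality
import HarnessLib

/-!
# K1L_D (stmt-AnomalousDissipation-27980), (ℓ3-A) road A, (S2-core): the DUALITY LOWER BOUND for a distorted dissipation form —
# `∫ Σ 𝔹 Du Du ≥ −∫⟪u, 𝓛^{𝔹ᵗ,*}χ⟫ − ∫⟪u, 𝓛^{𝔹,*}χ⟫ − ∫ Σ 𝔹 ∂χ ∂χ` for every smooth dual field `χ`
(helper; `--supports 27980 --as helper`; prover ad-k1loc-p3 g11; the engine of the (S2) loss-currency LOWER bounds: with `hEnergy : EnergyIdG …`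
the loss of a window map is `2∫` of the left side, and the right side is read off the WEAK FORMULATION of the member (pairings `⟪w, 𝓛^*χ⟫`)
and an explicit smooth quantity — no regularity of the `L²` solution beyond its weak gradient.)

Pointwise Young/duality for a NONNEGATIVE quadratic form `Q(ξ) = Σ_{l,i,c,e} 𝔹_{icle} ξ_{ci} ξ_{el}` (no symmetry assumed):
`Q(a) = Q(a−b) + B(a,b) + B(b,a) − Q(b) ≥ B(a,b) + B(b,a) − Q(b)`; with `a = Du(x)` (weak gradient, `a c i = (Du c x)_i`) and `b = ∇χ(x)`,
one integration by parts (`Torus.integral_inner_viscAdjVar_eq_neg_integral_sum`) turns `∫B(∇χ,Du)` into `−∫⟪u, viscAdjVar 𝔹 χ⟫` and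
`∫B(Du,∇χ)` into `−∫⟪u, viscAdjVar 𝔹ᵗ χ⟫`, `𝔹ᵗ(x) = majorTranspose (𝔹 x)`.
* §1 `quadForm_sub_expand`, `quadForm_ge_duality` (pointwise algebra);
* §2 `hasWeakGradient_of_hasWeakPartialDeriv` (adapter `Du : Fin 3 → VF` ↦ `Torus.HasWeakGradient`), `integral_bil_test_grad_eq_neg_inner_viscAdjVar`,
  `integral_bil_grad_test_eq_neg_inner_viscAdjVar_transpose`;
* §3 **`integral_quadForm_ge_duality`** (the integrated bound).
`sorry`-free; NOT a proof of any block, of K1L_D or of AD; rung F-D1.A0.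
-/

set_option linter.dupNamespace false

noncomputable section

namespace Summit.AnomalousDissipation.AnomalousDissipation.Theorems.SolenoidalFractalHomogenisation.LagrangianStep.VmodDist

open Literature.Analysis Literature.Analysis.FluidPDE Literature.Analysis.FunctionSpaces
open MeasureTheory Set
open scoped ENNReal InnerProductSpace

/-! ## §1 Pointwise duality for a nonnegative quadratic form -/

/-- Expansion of `Q(a − b)`. -/
theorem quadForm_sub_expand (𝔹₀ : Torus.Visc4 (Fin 3)) (a b : Fin 3 → Fin 3 → ℝ) :
    ∑ l, ∑ i, ∑ c, ∑ e, 𝔹₀ i c l e * (a c i - b c i) * (a e l - b e l)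
      = ∑ l, ∑ i, ∑ c, ∑ e, 𝔹₀ i c l e * a c i * a e l - ∑ l, ∑ i, ∑ c, ∑ e, 𝔹₀ i c l e * a c i * b e l
        - ∑ l, ∑ i, ∑ c, ∑ e, 𝔹₀ i c l e * b c i * a e l + ∑ l, ∑ i, ∑ c, ∑ e, 𝔹₀ i c l e * b c i * b e l := by
  have : ∀ l i c e, 𝔹₀ i c l e * (a c i - b c i) * (a e l - b e l)
      = 𝔹₀ i c l e * a c i * a e l - 𝔹₀ i c l e * a c i * b e l - 𝔹₀ i c l e * b c i * a e l + 𝔹₀ i c l e * b c i * b e l :=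
    fun l i c e => by ring
  simp only [this, Finset.sum_add_distrib, Finset.sum_sub_distrib]

/-- **Pointwise duality**: `Q(a − b) ≥ 0 ⇒ B(a,b) + B(b,a) − Q(b) ≤ Q(a)`. -/
theorem quadForm_ge_duality (𝔹₀ : Torus.Visc4 (Fin 3)) (a b : Fin 3 → Fin 3 → ℝ)
    (hQ : 0 ≤ ∑ l, ∑ i, ∑ c, ∑ e, 𝔹₀ i c l e * (a c i - b c i) * (a e l - b e l)) :
    ∑ l, ∑ i, ∑ c, ∑ e, 𝔹₀ i c l e * a c i * b e l + ∑ l, ∑ i, ∑ c, ∑ e, 𝔹₀ i c l e * b c i * a e l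
        - ∑ l, ∑ i, ∑ c, ∑ e, 𝔹₀ i c l e * b c i * b e l
      ≤ ∑ l, ∑ i, ∑ c, ∑ e, 𝔹₀ i c l e * a c i * a e l := by
  rw [quadForm_sub_expand] at hQ; linarith

/-! ## §2 Weak gradients in the `Du : Fin 3 → VF` format and the two integrations by parts -/

variable {𝔹 : UnitAddTorus (Fin 3) → Torus.Visc4 (Fin 3)} {u χ : VF} {Du : Fin 3 → VF}

/-- Adapter: slice weak partial derivatives `Du c` assemble into a `Torus.HasWeakGradient` (the CLM `v ↦ Σ_e v_e • Du e x`). -/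
theorem hasWeakGradient_of_hasWeakPartialDeriv (hD : ∀ c, Torus.HasWeakPartialDeriv c u (Du c)) :
    Torus.HasWeakGradient u (fun x => ∑ e, ContinuousLinearMap.smulRightL ℝ (EuclideanSpace ℝ (Fin 3)) (EuclideanSpace ℝ (Fin 3))
      (EuclideanSpace.proj e) (Du e x)) := by
  intro i
  have e1 : (fun x => (∑ e, ContinuousLinearMap.smulRightL ℝ (EuclideanSpace ℝ (Fin 3)) (EuclideanSpace ℝ (Fin 3))
      (EuclideanSpace.proj e) (Du e x)) (EuclideanSpace.single i (1 : ℝ))) = Du i := by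
    funext x
    simp
  rw [e1]; exact hD i

set_option maxHeartbeats 800000 in
/-- Integrability of the assembled weak gradient (each `Du e ∈ L²`). -/
theorem integrable_weakGradientCLM (hDu : ∀ c, MemLp (Du c) 2 volume) :
    Integrable (fun x => ∑ e, ContinuousLinearMap.smulRightL ℝ (EuclideanSpace ℝ (Fin 3)) (EuclideanSpace ℝ (Fin 3))
      (EuclideanSpace.proj e) (Du e x)) volume :=
  integrable_finsetSum _ fun e _ =>
    (ContinuousLinearMap.smulRightL ℝ (EuclideanSpace ℝ (Fin 3)) (EuclideanSpace ℝ (Fin 3)) (EuclideanSpace.proj e)).integrable_comp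
      ((hDu e).integrable one_le_two)

/-- **IBP, test-then-gradient order**: `∫ Σ 𝔹_{icle}(∂_cχ)_i (Du e)_l = −∫⟪u, viscAdjVar 𝔹 χ⟫`. -/
theorem integral_bil_test_grad_eq_neg_inner_viscAdjVar (h𝔹 : ∀ i c l e, Torus.IsSmooth (fun y => 𝔹 y i c l e)) (hχ : Torus.IsSmooth χ)
    (hu : MemLp u 2 volume) (hDu : ∀ c, MemLp (Du c) 2 volume) (hD : ∀ c, Torus.HasWeakPartialDeriv c u (Du c)) :
    ∫ x, ∑ l, ∑ i, ∑ c, ∑ e, 𝔹 x i c l e * (Torus.partialDeriv c χ x) i * (Du e x) l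
      = -∫ x, ⟪u x, Torus.viscAdjVar 𝔹 χ x⟫_ℝ := by
  have h := Torus.integral_inner_viscAdjVar_eq_neg_integral_sum (𝔹 := 𝔹) (Ψ := χ) (v := u) h𝔹 hχ (hu.integrable one_le_two)
    (hasWeakGradient_of_hasWeakPartialDeriv hD) (integrable_weakGradientCLM hDu)
  rw [h, neg_neg]
  refine integral_congr_ae (Filter.Eventually.of_forall fun x => ?_)
  refine Finset.sum_congr rfl fun l _ => Finset.sum_congr rfl fun i _ => Finset.sum_congr rfl fun c _ => Finset.sum_congr rfl fun e _ => ?_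
  simp

/-- **IBP, gradient-then-test order**: `∫ Σ 𝔹_{icle}(Du c)_i (∂_eχ)_l = −∫⟪u, viscAdjVar 𝔹ᵗ χ⟫`, `𝔹ᵗ(x) = majorTranspose (𝔹 x)`. -/
theorem integral_bil_grad_test_eq_neg_inner_viscAdjVar_transpose (h𝔹 : ∀ i c l e, Torus.IsSmooth (fun y => 𝔹 y i c l e))
    (hχ : Torus.IsSmooth χ) (hu : MemLp u 2 volume) (hDu : ∀ c, MemLp (Du c) 2 volume) (hD : ∀ c, Torus.HasWeakPartialDeriv c u (Du c)) :
    ∫ x, ∑ l, ∑ i, ∑ c, ∑ e, 𝔹 x i c l e * (Du c x) i * (Torus.partialDeriv e χ x) l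
      = -∫ x, ⟪u x, Torus.viscAdjVar (fun y => Torus.majorTranspose (𝔹 y)) χ x⟫_ℝ := by
  have h𝔹t : ∀ i c l e, Torus.IsSmooth (fun y => Torus.majorTranspose (𝔹 y) i c l e) := fun i c l e => by
    simp only [Torus.majorTranspose_apply]; exact h𝔹 l e i c
  rw [← integral_bil_test_grad_eq_neg_inner_viscAdjVar h𝔹t hχ hu hDu hD]
  refine integral_congr_ae (Filter.Eventually.of_forall fun x => ?_)
  -- reindex `(l,i,c,e) ↦ (i,l,e,c)`
  simp only [Torus.majorTranspose_apply]
  rw [Finset.sum_comm]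
  refine Finset.sum_congr rfl fun i _ => Finset.sum_congr rfl fun l _ => ?_
  rw [Finset.sum_comm]
  exact Finset.sum_congr rfl fun e _ => Finset.sum_congr rfl fun c _ => by ring

/-! ## §3 The integrated duality lower bound -/

/-- Sup bound of a continuous scalar field on the torus. -/
theorem exists_bound_of_continuous_torus {f : UnitAddTorus (Fin 3) → ℝ} (hf : Continuous f) : ∃ C, ∀ x, |f x| ≤ C := by
  obtain ⟨C, hC⟩ := isCompact_univ.exists_bound_of_continuousOn (hf.continuousOn (s := univ))
  exact ⟨C, fun x => by simpa [Real.norm_eq_abs] using hC x (mem_univ x)⟩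

/-- **(S2-core) DUALITY LOWER BOUND.**  For smooth coefficients `𝔹` with a pointwise NONNEGATIVE quadratic form, `u ∈ L²` with weak gradient
slices `Du c ∈ L²`, and a smooth dual field `χ`:
`−∫⟪u, 𝓛^{𝔹ᵗ,*}χ⟫ − ∫⟪u, 𝓛^{𝔹,*}χ⟫ − ∫ Σ 𝔹 ∂χ ∂χ ≤ ∫ Σ 𝔹 Du Du`. -/
theorem integral_quadForm_ge_duality (h𝔹 : ∀ i c l e, Torus.IsSmooth (fun y => 𝔹 y i c l e))
    (hQ : ∀ y (ξ : Fin 3 → Fin 3 → ℝ), 0 ≤ ∑ l, ∑ i, ∑ c, ∑ e, 𝔹 y i c l e * ξ c i * ξ e l)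
    (hu : MemLp u 2 volume) (hDu : ∀ c, MemLp (Du c) 2 volume) (hD : ∀ c, Torus.HasWeakPartialDeriv c u (Du c)) (hχ : Torus.IsSmooth χ) :
    -(∫ x, ⟪u x, Torus.viscAdjVar (fun y => Torus.majorTranspose (𝔹 y)) χ x⟫_ℝ) - (∫ x, ⟪u x, Torus.viscAdjVar 𝔹 χ x⟫_ℝ)
        - ∫ x, ∑ l, ∑ i, ∑ c, ∑ e, 𝔹 x i c l e * (Torus.partialDeriv c χ x) i * (Torus.partialDeriv e χ x) l
      ≤ ∫ x, ∑ l, ∑ i, ∑ c, ∑ e, 𝔹 x i c l e * (Du c x) i * (Du e x) l := by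
  have e1 := integral_bil_grad_test_eq_neg_inner_viscAdjVar_transpose h𝔹 hχ hu hDu hD
  have e2 := integral_bil_test_grad_eq_neg_inner_viscAdjVar h𝔹 hχ hu hDu hD
  -- integrability of the four integrands
  have h𝔹c : ∀ i c l e, Continuous (fun y => 𝔹 y i c l e) := fun i c l e => (h𝔹 i c l e).continuous
  have hDl : ∀ c i, MemLp (fun x => (Du c x) i) 2 volume := fun c i => (hDu c).eval_piLp i
  have hχl : ∀ c i, Continuous (fun x => (Torus.partialDeriv c χ x) i) := fun c i =>
    (PiLp.continuous_apply 2 (fun _ : Fin 3 => ℝ) i).comp (hχ.partialDeriv c).continuous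
  have hbdd : ∀ {f : UnitAddTorus (Fin 3) → ℝ}, Continuous f → ∀ {g : UnitAddTorus (Fin 3) → ℝ}, Integrable g volume →
      Integrable (fun x => f x * g x) volume := fun hf g hg => by
    obtain ⟨C, hC⟩ := exists_bound_of_continuous_torus hf
    exact hg.bdd_mul hf.aestronglyMeasurable (Filter.Eventually.of_forall fun x => by rw [Real.norm_eq_abs]; exact hC x)
  have iAA : Integrable (fun x => ∑ l, ∑ i, ∑ c, ∑ e, 𝔹 x i c l e * (Du c x) i * (Du e x) l) volume := by
    refine integrable_finsetSum _ fun l _ => integrable_finsetSum _ fun i _ => integrable_finsetSum _ fun c _ =>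
      integrable_finsetSum _ fun e _ => ?_
    have hp : Integrable (fun x => (Du c x) i * (Du e x) l) volume := (hDl c i).integrable_mul (hDl e l)
    exact (hbdd (h𝔹c i c l e) hp).congr (Filter.Eventually.of_forall fun x => by simp only; ring)
  have iAB : Integrable (fun x => ∑ l, ∑ i, ∑ c, ∑ e, 𝔹 x i c l e * (Du c x) i * (Torus.partialDeriv e χ x) l) volume := by
    refine integrable_finsetSum _ fun l _ => integrable_finsetSum _ fun i _ => integrable_finsetSum _ fun c _ =>
      integrable_finsetSum _ fun e _ => ?_
    have hp : Integrable (fun x => (𝔹 x i c l e * (Torus.partialDeriv e χ x) l) * (Du c x) i) volume :=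
      hbdd ((h𝔹c i c l e).mul (hχl e l)) ((hDl c i).integrable one_le_two)
    exact hp.congr (Filter.Eventually.of_forall fun x => by simp only; ring)
  have iBA : Integrable (fun x => ∑ l, ∑ i, ∑ c, ∑ e, 𝔹 x i c l e * (Torus.partialDeriv c χ x) i * (Du e x) l) volume := by
    refine integrable_finsetSum _ fun l _ => integrable_finsetSum _ fun i _ => integrable_finsetSum _ fun c _ =>
      integrable_finsetSum _ fun e _ => ?_
    exact hbdd ((h𝔹c i c l e).mul (hχl c i)) ((hDl e l).integrable one_le_two)
  have iBB : Integrable (fun x => ∑ l, ∑ i, ∑ c, ∑ e, 𝔹 x i c l e * (Torus.partialDeriv c χ x) i * (Torus.partialDeriv e χ x) l) volume :=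
    (continuous_finsetSum _ fun l _ => continuous_finsetSum _ fun i _ => continuous_finsetSum _ fun c _ =>
      continuous_finsetSum _ fun e _ => ((h𝔹c i c l e).mul (hχl c i)).mul (hχl e l)).integrable_unitAddTorus
  have key : ∫ x, ((∑ l, ∑ i, ∑ c, ∑ e, 𝔹 x i c l e * (Du c x) i * (Torus.partialDeriv e χ x) l)
      + (∑ l, ∑ i, ∑ c, ∑ e, 𝔹 x i c l e * (Torus.partialDeriv c χ x) i * (Du e x) l)
      - (∑ l, ∑ i, ∑ c, ∑ e, 𝔹 x i c l e * (Torus.partialDeriv c χ x) i * (Torus.partialDeriv e χ x) l))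
      ≤ ∫ x, ∑ l, ∑ i, ∑ c, ∑ e, 𝔹 x i c l e * (Du c x) i * (Du e x) l :=
    integral_mono ((iAB.add iBA).sub iBB) iAA fun x =>
      quadForm_ge_duality (𝔹 x) (fun c i => (Du c x) i) (fun c i => (Torus.partialDeriv c χ x) i) (hQ x _)
  have iS : Integrable (fun x => (∑ l, ∑ i, ∑ c, ∑ e, 𝔹 x i c l e * (Du c x) i * (Torus.partialDeriv e χ x) l)
      + (∑ l, ∑ i, ∑ c, ∑ e, 𝔹 x i c l e * (Torus.partialDeriv c χ x) i * (Du e x) l)) volume := iAB.add iBA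
  rw [integral_sub iS iBB, integral_add iAB iBA] at key
  linarith

end Summit.AnomalousDissipation.AnomalousDissipation.Theorems.SolenoidalFractalHomogenisation.LagrangianStep.VmodDist

end
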